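import Literature.Topology.FourManifolds.Knots
import Literature.Topology.FourManifolds.GluckTwist
import Literature.Topology.FourManifolds.SurgeryGluck
import Literature.Topology.FourManifolds.GluckTwistHomotopySphereProofs
import HarnessLib

/-!
# Torus surgery (logarithmic transformation) on a framed link of tori in `S⁴`; Iwase's theorem
"Gluck twists are torus surgeries"

Topic `Literature/Topology/FourManifolds`. Definition request `defn-IsTorusLinkSurgery` (route
SmoothPoincare4/HyperbolicTorusFillings, items `SingleLinkGeneration`, `LinkSurgeryPropertyP`,
`HyperbolicFillingsStandard`) and fact request `wi-11490` (Iwase 1988).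

## Content

* `IsTorusLinkSurgery IX X n T A` — the manifold `X` (modelled on `IX`) IS the result of a
  simultaneous torus surgery on `S⁴` along the framed link of tori `T` with regluing matrices `A`
  (relational form after `IsIntegralSurgeryLink` / `IsGluckTwist`, outline Design 3, open gluings):
  the `T i : (𝕊¹ × 𝕊¹) × ℝ² → 𝕊⁴` are smooth embeddings (framed open tubular neighbourhoods of the
  disjoint tori `x ↦ T i (x, 0)`) with pairwise disjoint ranges, `det (A i) = ±1`, and `X` is the
  open gluing of the core-complement `U = 𝕊⁴ ∖ ⋃ᵢ T i (𝕊¹ × 𝕊¹ × {0})` with `n` copies of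
  `(𝕊¹ × 𝕊¹) × ℝ²` along the fibre relation `a = T i (ψ_(A i) b)`, where
  `ψ_A (circlePoint θ₁, circlePoint θ₂, t • circlePoint θ₃) =
  (circlePoint (Aθ)₁, circlePoint (Aθ)₂, t • circlePoint (Aθ)₃)`, `t > 0`, is the linear `GL(3,ℤ)`
  regluing of `T³ × (0,∞)`. The body is VERBATIM the block inlined in the route items (with the
  target model generalised from `𝓡 4` to `IX`), so that they restate as one-liners
  (`isTorusLinkSurgery_iff` is `Iff.rfl` against the inline text). This is torus surgery /
  Dehn surgery along `T²`-knots as in Larson, *Surgery on tori in the 4-sphere* (2018), §2 (remove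
  `νT ≅ T² × D²`, reglue by a self-diffeomorphism of `T³`, an element of `GL(3,ℤ)`; the result
  depends only on the image `p[m] + a[α] + b[β]` of the meridian, i.e. on the third column of the
  matrix) and Iwase, Pacific J. Math. 133 (1988), §1 ("Dehn-surgery along a 2-torus embedded in
  `S⁴` … `N = T² × D²` and `π₀ Diff ∂N = GL₃ℤ`"), here for a LINK of `n` tori at once.
* `IsTorusLinkSurgery.nonempty` (proved).
* NAMED FACT `Iwase1988_gluckTwist_isTorusLinkSurgery` — Iwase 1988, Prop. 3.5: a Gluck twist of
  `S⁴` along a 2-knot is a torus surgery on `S⁴` along ONE torus (`n = 1`).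
* PROVED bridge `GluckTwistConjecture.of_iwase_of_torusSurgeryPropertyP`: Iwase's proposition and
  "four-dimensional Property P for torus link surgeries" (the statement of route item
  `LinkSurgeryPropertyP`, written over `IsTorusLinkSurgery`) imply the Gluck twist conjecture
  (`GluckTwistConjecture`, `SurgeryGluck.lean`), using the tree's PROVED theorem that Gluck twists
  are homotopy 4-spheres (`IsGluckTwist.nonempty_homotopyEquiv_sphere`, Gluck 1962 §17).

## Sources

* Z. Iwase, *Dehn-surgery along a torus T²-knot*, Pacific J. Math. 133 (1988) 289–299,
  doi:10.2140/pjm.1988.133.289 — read (msp open-access PDF): §1 p. 289 (the operation), Prop. 3.5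
  p. 296 ("If a closed 4-manifold `M` is obtained by Gluck-surgery along an `S²`-knot in `S⁴`,
  then `M` is also obtained by Dehn-surgery along a `T²`-knot in `S⁴`"), proof p. 297 (the torus
  `K'` is `K` with a trivial 1-handle attached), Cor. 3.8.
* K. Larson, *Surgery on tori in the 4-sphere*, Math. Proc. Cambridge Philos. Soc. (2018),
  arXiv:1502.06834, §1 ("by a theorem of Iwase [Iw1], the result of a Gluck twist can also be
  obtained by a certain related torus surgery"), §2 (torus surgery, multiplicity, `GL(3,ℤ)`).
* R. Gompf, A. Stipsicz, *4-Manifolds and Kirby Calculus* (1999), §8.3 (logarithmic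
  transformations).

## Design choices and wording risks

* Generality: `IX`, `X` arbitrary as in `IsGluckTwist`; the route instantiates `IX = 𝓡 4`,
  `X : Type` a Hausdorff second-countable smooth 4-manifold. All of `GL(3,ℤ)` is allowed although
  the surgery depends only on `±(A i)·e₃` (Larson §2); framings are absorbed into `T i` (the route's
  convention: no canonical-framing normalisation is imposed, so `(p, a, b)` are coordinates relative
  to the chosen `T i`, not Larson's canonical ones).
* Degenerate cases (checked by the requesting planner): `n = 0` forces `X ≅ 𝕊⁴`; `det = ±1` makes
  `ψ_A` a self-diffeomorphism of `T³ × (0,∞)`, so the fibre relation is the graph of an open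
  embedding with closed graph (Hausdorff pushout).
* Iwase's Prop. 3.5 as printed is an EXISTENCE statement ("along a `T²`-knot", some surgery type);
  the specific torus (`K` plus a trivial tube) and type (`(1, 0, ±1)`-related, Cor. 3.8) live in the
  proof and are not part of the vendored statement. "Obtained by" = "diffeomorphic to the result",
  which the relational `IsGluckTwist` / `IsTorusLinkSurgery` absorb (both are transport-invariant
  by design). Iwase works in the smooth category with closed `M`; a Gluck twist in the sense of
  `IsGluckTwist` is automatically a closed smooth 4-manifold (`IsGluckTwist.compactSpace_holds`).
-/

open scoped Manifold ContDiff Topology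
open Function Set

noncomputable section

namespace Literature.Topology.FourManifolds

universe u

/-- Local notation: `𝔼 n` is the model Euclidean space `EuclideanSpace ℝ (Fin n)`. -/
local notation "𝔼 " n:arg => EuclideanSpace ℝ (Fin n)

/-- Local notation: `𝕊 n` is the unit sphere in `EuclideanSpace ℝ (Fin (n + 1))`. -/
local notation "𝕊 " n:arg => (Metric.sphere (0 : EuclideanSpace ℝ (Fin (n + 1))) 1)

variable {EX HX : Type*} [NormedAddCommGroup EX] [NormedSpace ℝ EX] [TopologicalSpace HX]

/-- **Torus surgery on a framed link of tori in `S⁴`** (relational form). `IsTorusLinkSurgery IX X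
n T A`: the `T i : (𝕊¹ × 𝕊¹) × ℝ² → 𝕊⁴` are smooth embeddings with pairwise disjoint ranges
(framed open tubular neighbourhoods of `n` disjoint tori), the `A i ∈ GL(3,ℤ)` (`det = ±1`), and
`X` is the open gluing of the complement `U` of the core tori with `n` copies of
`(𝕊¹ × 𝕊¹) × ℝ²`: open smooth embeddings `jA : U → X`, `jB i : (𝕊¹ × 𝕊¹) × ℝ² → X`, jointly
surjective, the `jB i` with pairwise disjoint ranges, and `jA a = jB i b` iff
`b = ((circlePoint θ₁, circlePoint θ₂), t • circlePoint θ₃)` with `t > 0` and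
`a = T i ((circlePoint (Aθ)₁, circlePoint (Aθ)₂), t • circlePoint (Aθ)₃)`, `A = A i` acting
linearly on the angles — the `GL(3,ℤ)` regluing of `T³ × (0, ∞)` (Larson 2018, §2; Iwase 1988, §1;
Gompf–Stipsicz §8.3). Verbatim the block inlined in the items of route
SmoothPoincare4/HyperbolicTorusFillings (`isTorusLinkSurgery_iff`).
[cite: Larson2016, §2 (torus surgery, gluing by GL(3,ℤ))] -/
def IsTorusLinkSurgery (IX : ModelWithCorners ℝ EX HX) (X : Type*) [TopologicalSpace X]
    [ChartedSpace HX X] (n : ℕ) (T : Fin n → ((𝕊 1) × (𝕊 1)) × 𝔼 2 → 𝕊 4)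
    (A : Fin n → Matrix (Fin 3) (Fin 3) ℤ) : Prop :=
  (∀ i, Manifold.IsSmoothEmbedding (((𝓡 1).prod (𝓡 1)).prod 𝓘(ℝ, EuclideanSpace ℝ (Fin 2))) (𝓡 4) ∞
  (T i)) ∧ Pairwise (fun i j => Disjoint (Set.range (T i)) (Set.range (T j))) ∧ (∀ i, (A i).det = 1
  ∨ (A i).det = -1) ∧ ∃ (U : TopologicalSpace.Opens ↥(Metric.sphere (0 : EuclideanSpace ℝ (Fin 5))
  1)) (jA : ↥U → X) (jB : Fin n → (↥(Metric.sphere (0 : EuclideanSpace ℝ (Fin 2)) 1) ×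
  ↥(Metric.sphere (0 : EuclideanSpace ℝ (Fin 2)) 1)) × EuclideanSpace ℝ (Fin 2) → X), (U : Set
  ↥(Metric.sphere (0 : EuclideanSpace ℝ (Fin 5)) 1)) = (⋃ i, Set.range (fun x : (↥(Metric.sphere (0
  : EuclideanSpace ℝ (Fin 2)) 1) × ↥(Metric.sphere (0 : EuclideanSpace ℝ (Fin 2)) 1)) => T i (x,
  0)))ᶜ ∧ Manifold.IsSmoothEmbedding (𝓡 4) IX ∞ jA ∧ IsOpen (Set.range jA) ∧ (∀ i,
  Manifold.IsSmoothEmbedding (((𝓡 1).prod (𝓡 1)).prod 𝓘(ℝ, EuclideanSpace ℝ (Fin 2))) IX ∞ (jB i) ∧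
  IsOpen (Set.range (jB i))) ∧ Set.range jA ∪ (⋃ i, Set.range (jB i)) = Set.univ ∧ Pairwise (fun i j
  => Disjoint (Set.range (jB i)) (Set.range (jB j))) ∧ ∀ (i : Fin n) (a : ↥U) (b : (↥(Metric.sphere
  (0 : EuclideanSpace ℝ (Fin 2)) 1) × ↥(Metric.sphere (0 : EuclideanSpace ℝ (Fin 2)) 1)) ×
  EuclideanSpace ℝ (Fin 2)), (jA a = jB i b ↔ ∃ θ₁ θ₂ θ₃ t : ℝ, 0 < t ∧ b =
  ((Literature.Topology.FourManifolds.circlePoint (θ₁),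
  Literature.Topology.FourManifolds.circlePoint (θ₂)), t •
  ((Literature.Topology.FourManifolds.circlePoint (θ₃) : ↥(Metric.sphere (0 : EuclideanSpace ℝ (Fin
  2)) 1)) : EuclideanSpace ℝ (Fin 2))) ∧ (a : ↥(Metric.sphere (0 : EuclideanSpace ℝ (Fin 5)) 1)) = T
  i ((Literature.Topology.FourManifolds.circlePoint ((A i 0 0 : ℝ) * θ₁ + (A i 0 1 : ℝ) * θ₂ + (A i
  0 2 : ℝ) * θ₃), Literature.Topology.FourManifolds.circlePoint ((A i 1 0 : ℝ) * θ₁ + (A i 1 1 : ℝ)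
  * θ₂ + (A i 1 2 : ℝ) * θ₃)), t • ((Literature.Topology.FourManifolds.circlePoint ((A i 2 0 : ℝ) *
  θ₁ + (A i 2 1 : ℝ) * θ₂ + (A i 2 2 : ℝ) * θ₃) : ↥(Metric.sphere (0 : EuclideanSpace ℝ (Fin 2)) 1))
  : EuclideanSpace ℝ (Fin 2))))

/-- Unfolding of `IsTorusLinkSurgery` at `IX = 𝓡 4` into the literal block inlined in the items of
route SmoothPoincare4/HyperbolicTorusFillings (definitional, `Iff.rfl`). [folklore] -/
theorem isTorusLinkSurgery_iff (M : Type*) [TopologicalSpace M]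
    [ChartedSpace (EuclideanSpace ℝ (Fin 4)) M] (n : ℕ)
    (T : Fin n → (↥(Metric.sphere (0 : EuclideanSpace ℝ (Fin 2)) 1) ×
      ↥(Metric.sphere (0 : EuclideanSpace ℝ (Fin 2)) 1)) × EuclideanSpace ℝ (Fin 2) →
      ↥(Metric.sphere (0 : EuclideanSpace ℝ (Fin 5)) 1))
    (A : Fin n → Matrix (Fin 3) (Fin 3) ℤ) :
    IsTorusLinkSurgery (𝓡 4) M n T A ↔
      ((∀ i, Manifold.IsSmoothEmbedding (((𝓡 1).prod (𝓡 1)).prod 𝓘(ℝ, EuclideanSpace ℝ (Fin 2))) (𝓡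
      4) ∞ (T i)) ∧ Pairwise (fun i j => Disjoint (Set.range (T i)) (Set.range (T j))) ∧ (∀ i, (A
      i).det = 1 ∨ (A i).det = -1) ∧ ∃ (U : TopologicalSpace.Opens ↥(Metric.sphere (0 :
      EuclideanSpace ℝ (Fin 5)) 1)) (jA : ↥U → M) (jB : Fin n → (↥(Metric.sphere (0 : EuclideanSpace
      ℝ (Fin 2)) 1) × ↥(Metric.sphere (0 : EuclideanSpace ℝ (Fin 2)) 1)) × EuclideanSpace ℝ (Fin 2)
      → M), (U : Set ↥(Metric.sphere (0 : EuclideanSpace ℝ (Fin 5)) 1)) = (⋃ i, Set.range (fun x :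
      (↥(Metric.sphere (0 : EuclideanSpace ℝ (Fin 2)) 1) × ↥(Metric.sphere (0 : EuclideanSpace ℝ
      (Fin 2)) 1)) => T i (x, 0)))ᶜ ∧ Manifold.IsSmoothEmbedding (𝓡 4) (𝓡 4) ∞ jA ∧ IsOpen
      (Set.range jA) ∧ (∀ i, Manifold.IsSmoothEmbedding (((𝓡 1).prod (𝓡 1)).prod 𝓘(ℝ, EuclideanSpace
      ℝ (Fin 2))) (𝓡 4) ∞ (jB i) ∧ IsOpen (Set.range (jB i))) ∧ Set.range jA ∪ (⋃ i, Set.range (jB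
      i)) = Set.univ ∧ Pairwise (fun i j => Disjoint (Set.range (jB i)) (Set.range (jB j))) ∧ ∀ (i :
      Fin n) (a : ↥U) (b : (↥(Metric.sphere (0 : EuclideanSpace ℝ (Fin 2)) 1) × ↥(Metric.sphere (0 :
      EuclideanSpace ℝ (Fin 2)) 1)) × EuclideanSpace ℝ (Fin 2)), (jA a = jB i b ↔ ∃ θ₁ θ₂ θ₃ t : ℝ,
      0 < t ∧ b = ((Literature.Topology.FourManifolds.circlePoint (θ₁),
      Literature.Topology.FourManifolds.circlePoint (θ₂)), t •
      ((Literature.Topology.FourManifolds.circlePoint (θ₃) : ↥(Metric.sphere (0 : EuclideanSpace ℝ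
      (Fin 2)) 1)) : EuclideanSpace ℝ (Fin 2))) ∧ (a : ↥(Metric.sphere (0 : EuclideanSpace ℝ (Fin
      5)) 1)) = T i ((Literature.Topology.FourManifolds.circlePoint ((A i 0 0 : ℝ) * θ₁ + (A i 0 1 :
      ℝ) * θ₂ + (A i 0 2 : ℝ) * θ₃), Literature.Topology.FourManifolds.circlePoint ((A i 1 0 : ℝ) *
      θ₁ + (A i 1 1 : ℝ) * θ₂ + (A i 1 2 : ℝ) * θ₃)), t •
      ((Literature.Topology.FourManifolds.circlePoint ((A i 2 0 : ℝ) * θ₁ + (A i 2 1 : ℝ) * θ₂ + (A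
      i 2 2 : ℝ) * θ₃) : ↥(Metric.sphere (0 : EuclideanSpace ℝ (Fin 2)) 1)) : EuclideanSpace ℝ (Fin
      2))))) :=
  Iff.rfl

variable {IX : ModelWithCorners ℝ EX HX} {X : Type*} [TopologicalSpace X] [ChartedSpace HX X]

/-- A torus link surgery is non-empty: it contains the image of the core-complement `U`, which
contains the point `T i ((c₀, c₀), c₀)` off the cores if `n ≥ 1` (`c₀ = circlePoint 0`, a unit
vector), and is all of `𝕊⁴` if `n = 0`. [folklore] -/
theorem IsTorusLinkSurgery.nonempty {n : ℕ} {T : Fin n → ((𝕊 1) × (𝕊 1)) × 𝔼 2 → 𝕊 4}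
    {A : Fin n → Matrix (Fin 3) (Fin 3) ℤ} (h : IsTorusLinkSurgery IX X n T A) : Nonempty X := by
  obtain ⟨-, -, -, U, jA, jB, hU, -, -, -, hcover, -⟩ := h
  rcases Nat.eq_zero_or_pos n with rfl | hn
  · -- no tori: `U = 𝕊⁴`, take the image of any point of the sphere
    have hp : (⟨EuclideanSpace.single 0 1, by simp⟩ : 𝕊 4) ∈ (U : Set (𝕊 4)) := by
      rw [hU]
      simp
    exact ⟨jA ⟨_, hp⟩⟩
  · exact ⟨jB ⟨0, hn⟩ ((circlePoint 0, circlePoint 0), 0)⟩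

/-! ## Iwase: Gluck twists are torus surgeries -/

/-- **Iwase 1988, Prop. 3.5 — a Gluck twist is a torus surgery** (NAMED FACT, not proved here):
"If a closed 4-manifold `M` is obtained by Gluck-surgery along an `S²`-knot in `S⁴`, then `M` is
also obtained by Dehn-surgery along a `T²`-knot in `S⁴`" (Dehn surgery along a `T²`-knot = remove
`N = T² × D²`, reglue by an element of `π₀ Diff ∂N = GL₃ℤ`, loc. cit. §1). Rendered: for every
2-knot `K` and every Hausdorff second-countable smooth 4-manifold `X` that is a Gluck twist of
`𝕊⁴` along `K` (`IsGluckTwist (𝓡 4) X K`) there are ONE framed tube `T : (𝕊¹ × 𝕊¹) × ℝ² → 𝕊⁴` and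
a matrix `A ∈ GL(3,ℤ)` with `IsTorusLinkSurgery (𝓡 4) X 1 (fun _ => T) (fun _ => A)`. (In the proof
the torus is `K` with a trivial 1-handle attached and the type is that of Cor. 3.8; the printed
proposition asserts existence only.) Quoted in Larson 2018, §1: "by a theorem of Iwase [Iw1], the
result of a Gluck twist can also be obtained by a certain related torus surgery".
[cite: Iwase1988, Prop. 3.5 (p. 296)] -/
def Iwase1988_gluckTwist_isTorusLinkSurgery : Prop :=
  ∀ (K : TwoKnot) (X : Type u) [TopologicalSpace X] [T2Space X] [SecondCountableTopology X]
    [ChartedSpace (𝔼 4) X] [IsManifold (𝓡 4) ∞ X],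
    IsGluckTwist (𝓡 4) X K →
      ∃ (T : ((𝕊 1) × (𝕊 1)) × 𝔼 2 → 𝕊 4) (A : Matrix (Fin 3) (Fin 3) ℤ),
        IsTorusLinkSurgery (𝓡 4) X 1 (fun _ => T) (fun _ => A)

/-- **`LinkSurgeryPropertyP ⊇ GluckTwistConjecture`** (PROVED bridge). If Iwase's Prop. 3.5 holds
and every torus link surgery on `S⁴` that is homotopy equivalent to `𝕊⁴` is diffeomorphic to `𝕊⁴`
("four-dimensional Property P, link form" — literally the statement of item `LinkSurgeryPropertyP`
of route SmoothPoincare4/HyperbolicTorusFillings written over `IsTorusLinkSurgery`), then every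
Gluck twist is diffeomorphic to `𝕊⁴` (`GluckTwistConjecture`, universe `0`): a Gluck twist is a
homotopy 4-sphere (`IsGluckTwist.nonempty_homotopyEquiv_sphere`, Gluck 1962 §17, proved in the
tree) and, by Iwase, a one-torus surgery. [cite: Iwase1988, Prop. 3.5; Larson 2018 §1] -/
theorem GluckTwistConjecture.of_iwase_of_torusSurgeryPropertyP
    (hI : Iwase1988_gluckTwist_isTorusLinkSurgery.{0})
    (hP : ∀ (M : Type) [TopologicalSpace M] [T2Space M] [SecondCountableTopology M]
      [ChartedSpace (𝔼 4) M] [IsManifold (𝓡 4) ∞ M] (n : ℕ)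
      (T : Fin n → ((𝕊 1) × (𝕊 1)) × 𝔼 2 → 𝕊 4) (A : Fin n → Matrix (Fin 3) (Fin 3) ℤ),
      IsTorusLinkSurgery (𝓡 4) M n T A →
      ContinuousMap.HomotopyEquiv M (𝕊 4) → Nonempty (M ≃ₘ⟮𝓡 4, 𝓡 4⟯ (𝕊 4))) :
    GluckTwistConjecture.{0} := by
  intro K X _ _ _ _ _ hX
  obtain ⟨T, A, hT⟩ := hI K X hX
  obtain ⟨e⟩ := hX.nonempty_homotopyEquiv_sphere
  exact hP X 1 (fun _ => T) (fun _ => A) hT e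

end Literature.Topology.FourManifolds

end
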